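import Literature.NumberTheory.LFunctions.SuzukiWeilHilbertSpaceDefs
import Literature.NumberTheory.LFunctions.LiCoefficientArithmeticFormula
import HarnessLib

/-!
# Li coefficients as norms of functions in a model space (Suzuki 2023, JNT 252) — statements

LINE 1 — LABEL: this module types M. Suzuki, *Li coefficients as norms of functions in a model
space*, J. Number Theory **252** (2023) 177–194 (= arXiv:2301.05779v2) [Su23b], §1, §2 and §4.2
(held text `paper:arxiv-2301.05779`, pages `p0002`–`p0010`; TeX of record
`Suzuki2023JNT_arXiv2301.05779v2.tex`), AS PRINTED, over the tree's vocabulary. Its Theorem 1.1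
"RH ⟺ `λ_n = ‖G_n‖²/(2π)` for every `n ≥ 1`" is RH-EQUIVALENT (it is Li's criterion
`Literature.NumberTheory.LFunctions.li_criterion` with the non-negativity of `λ_n` made manifest
as a squared norm); the direction "identity ⟹ RH" is RH-FREE ("The Riemann hypothesis follows
trivially from equation (1.6) by Li's criterion", p. 2 L113), the direction "RH ⟹ identity" is
an RH-CONSEQUENCE. Lemma 2.1 and Propositions 2.1–2.3 are RH-FREE statements about explicit
meromorphic functions. Typing this corpus fixes WHICH identity would prove RH through this door;
it does not move RH. WHAT THIS IS NOT: not a route, not a proof plan for RH, no positivity is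
asserted; nothing here bears on the truth of RH. (Cell rh-crit/dbl bookkeeping: bears_on L-C/L-P,
Li column; bridge to the de Branges column only through `E_ξ`, `Θ_ξ`.)

## Dictionary (paper ↦ tree), fixed once here

* `ξ(s) = ½ s(s−1)π^{−s/2}Γ(s/2)ζ(s)` (p. 2 L60) = `riemannXi` (identical normalisation).
* `λ_n = Σ_ρ [1 − (1 − 1/ρ)ⁿ]` (eq. (1.1), p. 2 L8: `Σ_ρ = lim_T Σ_{|Im ρ| ≤ T}`, with
  multiplicity) = `keiperLiCoeff n`, by the tree's PROVED `keiperLiCoeff_eq_zero_sum_holds` /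
  `keiperLiCoeff_eq_tsum_zeros` (Li 1997 (1.4) = B–L (1.3)); `λ_n` is never re-defined here.
* `𝒵` = "the set of all distinct zeros `ρ` of `ξ(s)`", `m_ρ` = the multiplicity (p. 4 L5–8)
  = the subtype of `ZetaZeros.riemannZetaNontrivialZeros`, `m(ρ) = riemannZetaZeroOrder ρ` (the
  zeros of `ξ` are exactly the non-trivial zeros of `ζ`, `riemannXi_eq_zero_iff_holds`, with the
  same multiplicity, `untop₀_meromorphicOrderAt_riemannXi`). Every `Σ_{ρ∈𝒵} m_ρ(…)` below is an
  unconditional sum (`HasSum` / `tsum`) over that subtype — the sums of §2 converge absolutely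
  (Lemma 2.1), and so do the bracketed sums (3.8)/(3.9) ("converges absolutely under the curly
  brackets", p. 8 L157).
* `η_k`, "coefficients of the Laurent expansion `−ζ′/ζ(s+1) = 1/s + Σ_{k≥0} η_k s^k`"
  (eq. (1.3), p. 2 L63–67) = the tree's `liEta k` (`LiCoefficientArithmeticFormula.lean`: the
  Bombieri–Lagarias / Coffey `η_k := ((−1)^k/k!) lim_N (Σ_{m≤N} Λ(m) log^k m/m − log^{k+1}N/(k+1))`,
  B–L (4.1) — the very formula the paper uses for its `η_k` on p. 5 L95–101). SAME sign and
  normalisation (the tree's convention `ζ′/ζ(s) = −(s−1)^{−1} − Σ_p η_p (s−1)^p` is (1.3) at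
  `s ↦ s + 1`). The EXACT RELATION is the typed statement `Suzuki2023b_eq_s103`: the Laurent
  expansion (1.3) HOLDS with `η_k := liEta k` (coefficients of a convergent power series being
  unique, this identifies the paper's `η_k` with `liEta k`); it is discharged in the sibling
  `LiCoefficientsModelSpaceProofs.lean` from `liEta_eq_neg_re_zetaOneLogDerivCoeff`.
* `E(z) = ξ(1/2 − iz) + ξ′(1/2 − iz)`, `Θ = E♯/E` (eqs. (3.1)–(3.2), p. 7 L80–88) = `lagariasE`,
  `lagariasTheta` (`SuzukiWeilHilbertSpaceDefs.lean`); `ρ = 1/2 − iγ` (p. 8 L78) ⟺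
  `γ = suzukiZeroParam ρ`; `i ξ(s)/(ξ(s)+ξ′(s)) = i(1+Θ(z))/2` at `s = 1/2 − iz` (p. 8 L95).
* the arithmetic formula (1.7) "`λ_n = −Σ_{j=1}^n C(n,j)η_{j−1} + 1 − (γ₀ + log 4π)n/2
  − Σ_{j=2}^n C(n,j)(−1)^{j−1}(1−2^{−j})ζ(j)`, obtained in [BoLa99]" (p. 2 L148–159) IS the
  tree's PROVED `Coffey2005_thm1` (ii) (`keiperLiCoeff n = liTrend n + liOscPart n`,
  `Coffey2005_thm1_holds`); CITED, not retyped (its printed shape is derived in the Proofs file).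
* Li's criterion = `li_criterion`, PROVED (`li_criterion_holds`).

## What is typed here (node ids of the cell's `NODES.tsv` in brackets)

Definitions with bodies: `bombieriLagariasTestFun n` (`g_n`, the display after (1.2),
p. 2 L41–47), `liModelM n` (`M_n`, eq. (2.1), p. 4 L19–24) [Su23b:def-M_n], `liModelHFormula n`
(the displayed formula (1.4) for `H_n`, p. 2 L69–89) and `liModelH n` (the meromorphic function
`H_n` that formula defines, removable singularities removed — see its docstring)
[Su23b:def-H_n], `liModelG n` (`G_n(z) := H_n(1/2 − iz)`, eq. (1.5), p. 2 L93–95)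
[Su23b:def-G_n], `liModelGNormSq n` (`‖G_n‖²_{L²(ℝ)}`).
Named statements (`def … : Prop`, D-0014; each carries its LABEL on line 1 of its docstring and
is to be discharged as `…_holds` in `LiCoefficientsModelSpaceProofs.lean` where RH-FREE):
`Suzuki2023b_eq_s103` [Su23b:eta-dictionary], `Suzuki2023b_lemma21` (Lemma 2.1),
`Suzuki2023b_prop21` [Su23b:P2.1], `Suzuki2023b_eq_s212` (eq. (2.9) in its proof),
`Suzuki2023b_prop22` [Su23b:P2.2], `Suzuki2023b_prop23_1` … `Suzuki2023b_prop23_5` [Su23b:P2.3 —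
UNCONDITIONAL in print, p. 6 L95–126, "basic analytic properties … not directly necessary for the
main results"], `Suzuki2023b_thm11_if` [Su23b:T1.1-if], `Suzuki2023b_thm11_onlyif`
[Su23b:T1.1-onlyif], `Suzuki2023b_thm11` (the printed ⟺), `Suzuki2023b_eq_s301` (`‖G_n‖²` as a
zero sum under RH, eq. (3.8), p. 8 L145–155), `Suzuki2023b_eq_s302` (`λ_n` as the same zero sum,
eq. (3.9), p. 8 L172–184), `Suzuki2023b_eq0225_1` (the expansion (3.6) of `G_n`, pointwise) and
`Suzuki2023b_mellin_testFun` (`ĝ_n(ρ) = 1 − (1−1/ρ)ⁿ`) [Su23b:S5.2-relation, §4.2, p. 10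
L70–100].

## Deliberately NOT here

* §3.1–§3.3 (model spaces; Prop. 3.1 "RH ⟺ `E ∈ HB` ⟺ `Θ` meromorphic inner", quoting
  [La06, Thm 1]; Prop. 3.2, the orthonormal basis `F_γ` of `𝒦(Θ)` UNDER RH): typed by the cell's
  module `LagariasXiStructureFunction.lean` (never an unconditional `IsHermiteBiehler lagariasE`).
* eq. (1.2) `2λ_n = W(g_n ∗ \overline{x^{−1}g_n(x^{−1})})` [BoLa99] and the Weil distribution `W`:
  Bombieri–Lagarias 1999 §5, primary not held by the store; the Weil form is the tree's
  `weilQuadratic` (column W). §4.2's transformation `𝒯` and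
  `W(f ∗ \overline{x^{−1}f(x^{−1})}) = π^{−1}‖𝒯f‖²` exist only under RH (they use Prop. 3.2's
  basis) and are "the subject of [Su23] and not of this paper" (p. 10 L90–92; `[Su23]` =
  `SuzukiWeilHilbertSpaceDefs.lean`'s objects); recorded as remarks in the docstrings of
  `Suzuki2023b_eq0225_1` / `Suzuki2023b_mellin_testFun`, whose RH-free content is typed.
* §4.1 (discussion, no statement: why `λ_1 = ‖G_1‖²/(2π)` cannot be confirmed unconditionally).
-/

noncomputable section

open MeasureTheory Complex Filter Set Finset
open scoped Topology ComplexConjugate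

namespace Literature.NumberTheory.LFunctions

/-! ## The objects -/

/-- The Bombieri–Lagarias test function `g_n` (RH-FREE object):
`g_n(x) = Σ_{j=1}^n C(n,j) (log x)^{j−1}/(j−1)!` for `0 < x < 1`, `g_n(1) = n/2`, `g_n(x) = 0`
for `x > 1` (a function on `ℝ_{>0}`; junk value `0` for `x ≤ 0`). Its Mellin transform is
`ĝ_n(ρ) = 1 − (1 − 1/ρ)ⁿ` (`Suzuki2023b_mellin_testFun`).
[cite: Suzuki2023b, display after eq. (1.2), p. 2 L41–47 (from BombieriLagarias1999)] -/
def bombieriLagariasTestFun (n : ℕ) (x : ℝ) : ℝ :=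
  if 0 < x ∧ x < 1 then
    ∑ j ∈ Icc 1 n, (n.choose j : ℝ) * Real.log x ^ (j - 1) / ((j - 1).factorial : ℝ)
  else if x = 1 then (n : ℝ) / 2 else 0

/-- Suzuki's `M_n(s) := −i Σ_{ρ ∈ 𝒵} m_ρ [1 − (1 − 1/ρ)ⁿ] (s − ρ)^{−1}` (Lemma 2.1, eq. (2.1)),
the sum over the distinct zeros of `ξ` with multiplicity — here the unconditional sum over the
subtype of non-trivial zeros of `ζ` with `m(ρ) = riemannZetaZeroOrder ρ` (module dictionary).
RH-FREE object. The series converges absolutely off `𝒵` (`Suzuki2023b_lemma21`); AT a point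
`ρ₀ ∈ 𝒵` (a pole of `M_n`) the value is junk (Lean's `1/0 = 0` drops the `ρ₀`-term).
[cite: Suzuki2023b, Lemma 2.1, eq. (2.1), p. 4 L16–24] -/
def liModelM (n : ℕ) (s : ℂ) : ℂ :=
  -I * ∑' ρ : ZetaZeros.riemannZetaNontrivialZeros,
    (riemannZetaZeroOrder (ρ : ℂ) : ℂ) * (1 - (1 - 1 / (ρ : ℂ)) ^ n) / (s - ρ)

/-- The DISPLAYED FORMULA (1.4) for `H_n(s)`, literally:
`H_n(s) = ξ(s)/(ξ(s)+ξ′(s)) · { 1/(s−1) + [1 − (1 − 1/s)ⁿ]·(ξ′/ξ(s) − 1/(s−1) − ξ′/ξ(0) − 1)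
  − Σ_{j=2}^n C(n,j) (−1)^{j−1} s^{−j} Σ_{k=1}^{j−1} [(−1)^k η_k + (1 − 2^{−k−1}) ζ(k+1)] s^k }`
("the second line … is understood to be zero when `n = 1`": the `j`-sum over `Icc 2 1` is
empty), with `η_k = liEta k` (module dictionary), `ξ′/ξ(0) = ξ′(0)/ξ(0)` (`ξ(0) = 1/2`).
RH-FREE object. Lean's division conventions give JUNK values exactly at `s = 0`, `s = 1`, at the
zeros of `ξ` (where the paper's `H_n` has REMOVABLE singularities, Prop. 2.1 / Prop. 2.3 (3)) and
at the zeros of `ξ + ξ′`; the meromorphic function itself is `liModelH`.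
[cite: Suzuki2023b, eq. (1.4), p. 2 L69–89] -/
def liModelHFormula (n : ℕ) (s : ℂ) : ℂ :=
  riemannXi s / (riemannXi s + deriv riemannXi s) *
    (1 / (s - 1) +
      (1 - (1 - 1 / s) ^ n) *
        (deriv riemannXi s / riemannXi s - 1 / (s - 1) - deriv riemannXi 0 / riemannXi 0 - 1) -
      ∑ j ∈ Icc 2 n, (n.choose j : ℂ) * (-1) ^ (j - 1) / s ^ j *
        ∑ k ∈ Icc 1 (j - 1),
          ((-1) ^ k * (liEta k : ℂ) + (1 - 1 / 2 ^ (k + 1)) * riemannZeta ((k : ℂ) + 1)) * s ^ k)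

/-- Suzuki's meromorphic function `H_n(s)` "defined by (1.4)": its value at `s` is the limit of
the displayed formula `liModelHFormula n` along the punctured neighbourhood of `s`
(`limUnder (𝓝[≠] s)`) — i.e. the formula wherever the formula is continuous
(`liModelH_eq_formula`), with the REMOVABLE singularities (at `s = 0, 1` and at the zeros of
`ξ`: "`ρ ∈ 𝒵` are removable poles of `H_n(s)`", Prop. 2.1; Prop. 2.3 (3)) filled by continuity,
and an unspecified junk value only at the genuine poles (certain zeros `λ ∉ 𝒵` of `ξ + ξ′`,
Prop. 2.3 (4)). This is the reading under which Prop. 2.2 ("`G_n` is real-analytic on `ℝ`") is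
printed: the literal formula has the junk value `0 ≠ lim = 1 − (1 − 1/ρ)ⁿ` at every critical
zero. RH-FREE object. [cite: Suzuki2023b, eq. (1.4), p. 2 L69–89; Prop. 2.1, p. 4 L53] -/
def liModelH (n : ℕ) (s : ℂ) : ℂ :=
  limUnder (𝓝[≠] s) (liModelHFormula n)

/-- `G_n(z) := H_n(1/2 − iz)` (eq. (1.5)). RH-FREE object; on the real line it is bounded,
real-analytic and square-integrable UNCONDITIONALLY (Prop. 2.2, `Suzuki2023b_prop22`).
[cite: Suzuki2023b, eq. (1.5), p. 2 L90–98] -/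
def liModelG (n : ℕ) (z : ℂ) : ℂ :=
  liModelH n (1 / 2 - I * z)

/-- `‖G_n‖²_{L²(ℝ)} = ∫_ℝ |G_n(x)|² dx` (Thm. 1.1: "`‖·‖_{L²(ℝ)}` … stands for the norm of
`L²(ℝ)`"). By Prop. 2.2 `G_n ∈ L²(ℝ)`, so this Bochner integral is the genuine squared
`L²`-norm of the class of `G_n|_ℝ` (for a non-square-integrable function it would be the junk
value `0`). [cite: Suzuki2023b, Thm. 1.1, eq. (1.6), p. 2 L105–111] -/
def liModelGNormSq (n : ℕ) : ℝ :=
  ∫ x : ℝ, ‖liModelG n (x : ℂ)‖ ^ 2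

/-! ## Unfolding lemmas (plumbing for the case split and the limit) -/

/-- `g_n(x) = Σ_{j=1}^n C(n,j)(log x)^{j−1}/(j−1)!` on `(0,1)`.
[cite: Suzuki2023b, display after eq. (1.2), p. 2 L44] -/
theorem bombieriLagariasTestFun_of_mem_Ioo {n : ℕ} {x : ℝ} (hx : x ∈ Set.Ioo (0 : ℝ) 1) :
    bombieriLagariasTestFun n x =
      ∑ j ∈ Icc 1 n, (n.choose j : ℝ) * Real.log x ^ (j - 1) / ((j - 1).factorial : ℝ) := by
  simp [bombieriLagariasTestFun, hx.1, hx.2]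

/-- `g_n(1) = n/2`. [cite: Suzuki2023b, display after eq. (1.2), p. 2 L45] -/
theorem bombieriLagariasTestFun_one (n : ℕ) : bombieriLagariasTestFun n 1 = (n : ℝ) / 2 := by
  simp [bombieriLagariasTestFun]

/-- `g_n(x) = 0` for `x > 1`. [cite: Suzuki2023b, display after eq. (1.2), p. 2 L46] -/
theorem bombieriLagariasTestFun_of_one_lt {n : ℕ} {x : ℝ} (hx : 1 < x) :
    bombieriLagariasTestFun n x = 0 := by
  have h1 : ¬ (0 < x ∧ x < 1) := fun h ↦ by linarith [h.2]
  have h2 : x ≠ 1 := ne_of_gt hx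
  simp [bombieriLagariasTestFun, h1, h2]

/-- Where the displayed formula (1.4) is continuous, `H_n` IS the formula (the limit along the
punctured neighbourhood of a point of continuity is the value).
[cite: Suzuki2023b, eq. (1.4), p. 2 L69–89] -/
theorem liModelH_eq_formula {n : ℕ} {s : ℂ} (h : ContinuousAt (liModelHFormula n) s) :
    liModelH n s = liModelHFormula n s :=
  (h.tendsto.mono_left nhdsWithin_le_nhds).limUnder_eq

/-- The displayed formula (1.4) is continuous at every `s ≠ 0, 1` with `ξ(s) ≠ 0` and
`ξ(s) + ξ′(s) ≠ 0` (its ingredients are entire functions and the divisions are by non-zero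
quantities there). [cite: Suzuki2023b, eq. (1.4), p. 2 L69–89] -/
theorem continuousAt_liModelHFormula (n : ℕ) {s : ℂ} (h0 : s ≠ 0) (h1 : s ≠ 1)
    (hξ : riemannXi s ≠ 0) (hE : riemannXi s + deriv riemannXi s ≠ 0) :
    ContinuousAt (liModelHFormula n) s := by
  have hξc : ∀ z, ContinuousAt riemannXi z := fun z ↦
    differentiable_riemannXi.continuous.continuousAt
  have hξ'c : ∀ z, ContinuousAt (deriv riemannXi) z := fun z ↦
    ((differentiable_riemannXi.contDiff (n := 2)).differentiable_deriv_two).continuous.continuousAt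
  have hs1 : s - 1 ≠ 0 := sub_ne_zero.mpr h1
  have hinv1 : ContinuousAt (fun z : ℂ ↦ 1 / (z - 1)) s :=
    continuousAt_const.div₀ (continuousAt_id.sub continuousAt_const) hs1
  have hinv0 : ContinuousAt (fun z : ℂ ↦ 1 / z) s := continuousAt_const.div₀ continuousAt_id h0
  have hpow : ∀ j : ℕ, ContinuousAt (fun z : ℂ ↦ z ^ j) s := fun j ↦
    (continuous_pow j).continuousAt
  have hsum : ContinuousAt (fun z : ℂ ↦ ∑ j ∈ Icc 2 n, (n.choose j : ℂ) * (-1) ^ (j - 1) / z ^ j *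
      ∑ k ∈ Icc 1 (j - 1),
        ((-1) ^ k * (liEta k : ℂ) + (1 - 1 / 2 ^ (k + 1)) * riemannZeta ((k : ℂ) + 1)) * z ^ k)
      s := by
    refine tendsto_finsetSum _ fun j _ ↦ ?_
    refine ContinuousAt.mul (continuousAt_const.div₀ (hpow j) (pow_ne_zero j h0)) ?_
    exact tendsto_finsetSum _ fun k _ ↦ continuousAt_const.mul (hpow k)
  have hlog : ContinuousAt (fun z : ℂ ↦ deriv riemannXi z / riemannXi z) s :=
    (hξ'c s).div₀ (hξc s) hξ
  unfold liModelHFormula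
  exact ((hξc s).div₀ ((hξc s).add (hξ'c s)) hE).mul
    ((hinv1.add ((continuousAt_const.sub ((continuousAt_const.sub hinv0).pow n)).mul
      (((hlog.sub hinv1).sub continuousAt_const).sub continuousAt_const))).sub hsum)

/-- At every `s ≠ 0, 1` with `ξ(s) ≠ 0`, `ξ(s) + ξ′(s) ≠ 0`, `H_n(s)` is given by the displayed
formula (1.4). [cite: Suzuki2023b, eq. (1.4), p. 2 L69–89] -/
theorem liModelH_eq_formula_of_ne (n : ℕ) {s : ℂ} (h0 : s ≠ 0) (h1 : s ≠ 1)
    (hξ : riemannXi s ≠ 0) (hE : riemannXi s + deriv riemannXi s ≠ 0) :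
    liModelH n s = liModelHFormula n s :=
  liModelH_eq_formula (continuousAt_liModelHFormula n h0 h1 hξ hE)

/-! ## §1: the Laurent coefficients `η_k` (the dictionary, as a statement) -/

/-- RH-FREE. **Eq. (1.3), the definition of the `η_k`, holds with `η_k := liEta k`**: there is
`r > 0` such that for every `0 < |s| < r`,
`−ζ′/ζ(s+1) − 1/s = Σ_{k≥0} η_k s^k` (convergent power series). Printed as the DEFINITION of
`η_k` ("coefficients of the Laurent expansion `−ζ′/ζ(s+1) = 1/s + Σ_{k=0}^∞ η_k s^k`"); with the
tree's `liEta` (the B–L limit formula (4.1), which the paper invokes on p. 5 L95–101) it is a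
theorem, and by uniqueness of power-series coefficients it IDENTIFIES the paper's `η_k` with
`liEta k` (same sign, same normalisation). Discharged in `LiCoefficientsModelSpaceProofs.lean`.
[cite: Suzuki2023b, eq. (1.3), p. 2 L63–67] -/
def Suzuki2023b_eq_s103 : Prop :=
  ∃ r : ℝ, 0 < r ∧ ∀ s : ℂ, s ≠ 0 → ‖s‖ < r →
    HasSum (fun k : ℕ ↦ (liEta k : ℂ) * s ^ k)
      (-(deriv riemannZeta (s + 1) / riemannZeta (s + 1)) - 1 / s)

/-! ## §2.1: Lemma 2.1 and the two unconditional propositions -/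

/-- RH-FREE. **[Su23b] Lemma 2.1** ("`M_n(s)` is a meromorphic function on `ℂ` such that all
poles are simple and `𝒵` is the set of all poles"; proof: "the series … converges absolutely
and uniformly on every compact subset of `ℂ ∖ 𝒵`, since `Σ_ρ m_ρ|ρ|^{−1−δ} < ∞`"), typed as:
for every `n ≥ 1`, (i) the series (2.1) converges absolutely at every `s ∉ 𝒵`; (ii) `M_n` is
holomorphic on `ℂ ∖ 𝒵`; (iii) at every `ρ ∈ 𝒵`, `(s − ρ)M_n(s) → −i m_ρ[1 − (1 − 1/ρ)ⁿ]` as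
`s → ρ` (a pole of order at most one with this residue). FAITHFULNESS NOTE: the printed clause
"`𝒵` is the set of ALL poles" says in addition that every residue is non-zero, i.e.
`(1 − 1/ρ)ⁿ ≠ 1` for every `ρ ∈ 𝒵`; this is automatic off the critical line (`|1 − 1/ρ| ≠ 1`)
and on it amounts to `ρ ≠ ½ + (i/2)cot(πk/n)` (`0 < k < n`), which the printed proof does not
address; (iii) records the residue, which is what (2.2)/(2.9) use, and does not assert its
non-vanishing. [cite: Suzuki2023b, Lemma 2.1, p. 4 L16–38] -/
def Suzuki2023b_lemma21 : Prop :=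
  ∀ n : ℕ, 1 ≤ n →
    (∀ s : ℂ, s ∉ ZetaZeros.riemannZetaNontrivialZeros →
      Summable fun ρ : ZetaZeros.riemannZetaNontrivialZeros ↦
        (riemannZetaZeroOrder (ρ : ℂ) : ℂ) * (1 - (1 - 1 / (ρ : ℂ)) ^ n) / (s - ρ)) ∧
    DifferentiableOn ℂ (liModelM n) ZetaZeros.riemannZetaNontrivialZerosᶜ ∧
    ∀ ρ ∈ ZetaZeros.riemannZetaNontrivialZeros,
      Tendsto (fun s ↦ (s - ρ) * liModelM n s) (𝓝[≠] ρ)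
        (𝓝 (-I * (riemannZetaZeroOrder ρ : ℂ) * (1 - (1 - 1 / ρ) ^ n)))

/-- RH-FREE. **[Su23b] Proposition 2.1** (eq. (2.2)): for every `n ≥ 1`,
`H_n(s) = i ξ(s)/(ξ(s)+ξ′(s)) · M_n(s)` "for `s ∈ ℂ`", and "`ρ ∈ 𝒵` are removable poles of
`H_n(s)`". Typed as: (i) the identity at every `s` with `ξ(s) ≠ 0` and `ξ(s)+ξ′(s) ≠ 0` (both
sides are then honest values; at `s ∈ 𝒵` the right-hand side is the meromorphic product `0 · ∞`
and at the remaining zeros of `ξ + ξ′` both sides are `∞` — excluded, as for any identity of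
meromorphic functions); (ii) at every `ρ ∈ 𝒵` the displayed formula (1.4) has a finite limit
along the punctured neighbourhood (the singularity is removable; by definition `liModelH n ρ` is
then that limit). Printed proof: Weil's explicit formula ([Bo01, p. 186], test functions of
[BoLa99, §3]) applied to a truncation `f_{s,n,ε}` of the multiplicative convolution of `g_n` with
`−i x^{−s}𝟙_{(1,∞)}`, `ε → 0+`, then analytic continuation from `Re s > 1`; removability from
(2.9) (`Suzuki2023b_eq_s212`). Dischargeable RH-FREE (alternatively from the tree's Hadamard
partial fractions of `ξ′/ξ` and the arithmetic formula `Coffey2005_thm1_holds`).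
[cite: Suzuki2023b, Prop. 2.1, eq. (2.2), p. 4 L41–53] -/
def Suzuki2023b_prop21 : Prop :=
  ∀ n : ℕ, 1 ≤ n →
    (∀ s : ℂ, riemannXi s ≠ 0 → riemannXi s + deriv riemannXi s ≠ 0 →
      liModelH n s =
        I * riemannXi s / (riemannXi s + deriv riemannXi s) * liModelM n s) ∧
    ∀ ρ ∈ ZetaZeros.riemannZetaNontrivialZeros,
      ∃ c : ℂ, Tendsto (liModelHFormula n) (𝓝[≠] ρ) (𝓝 c)

/-- RH-FREE. **[Su23b] eq. (2.9)** (in the proof of Prop. 2.1): near a zero `ρ ∈ 𝒵` of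
multiplicity `m_ρ`, `ξ(s)/(ξ(s)+ξ′(s)) = (s − ρ)(1/m_ρ + o(1))`, "by using the series expansion
`ξ(s) = c(m_ρ)(s−ρ)^{m_ρ}(1+o(1))` (`c(m_ρ) ≠ 0`)". Typed as the limit
`ξ(s)/((ξ(s)+ξ′(s))(s−ρ)) → 1/m_ρ` along `s → ρ`, `s ≠ ρ`.
[cite: Suzuki2023b, eq. (2.9), p. 6 L26–36] -/
def Suzuki2023b_eq_s212 : Prop :=
  ∀ ρ ∈ ZetaZeros.riemannZetaNontrivialZeros,
    Tendsto (fun s ↦ riemannXi s / ((riemannXi s + deriv riemannXi s) * (s - ρ))) (𝓝[≠] ρ)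
      (𝓝 (1 / (riemannZetaZeroOrder ρ : ℂ)))

/-- RH-FREE. **[Su23b] Proposition 2.2**: for every `n ≥ 1`, "the restriction of `G_n(z)` to
the real line (`z ∈ ℝ`) is bounded, real-analytic, and belongs to `L²(ℝ)`" — UNCONDITIONALLY
(p. 2 L97–98: "`G_n(z)` is continuous on the real line and belongs to `L²(ℝ)` unconditionally").
Typed for `liModelG n` (removable singularities filled, see `liModelH`): a uniform bound on `ℝ`,
`AnalyticOnNhd ℝ` of `x ↦ G_n(x)` on all of `ℝ`, and `MemLp … 2`. Printed proof: on `Re s = ½`,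
`|(ξ(1−s)+ξ′(1−s))/(ξ(s)+ξ′(s))| = 1` (functional equations), removability at `𝒵` (Prop. 2.1),
and `H_n(s) ≪ |s|^{−1} log|s|` from `ψ(s/2) ≪ log|s|` and `ζ′/ζ(s) = Σ_{|t−γ|≤1}(s−ρ)^{−1}
+ O(log t)` [Tit86, Thm 9.6 (A), Thm 9.2]. Dischargeable.
[cite: Suzuki2023b, Prop. 2.2, p. 6 L41–93] -/
def Suzuki2023b_prop22 : Prop :=
  ∀ n : ℕ, 1 ≤ n →
    (∃ C : ℝ, ∀ x : ℝ, ‖liModelG n (x : ℂ)‖ ≤ C) ∧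
    AnalyticOnNhd ℝ (fun x : ℝ ↦ liModelG n (x : ℂ)) Set.univ ∧
    MemLp (fun x : ℝ ↦ liModelG n (x : ℂ)) 2 volume

/-! ## §2.2: Proposition 2.3 — basic analytic properties of `H_n` (unconditional; "for the
convenience of subsequent studies although not directly necessary for the main results") -/

/-- RH-FREE. **[Su23b] Proposition 2.3 (1)**: "`H_n(s)` are meromorphic functions on `ℂ` taking
real values on the real line" (`n ≥ 1`). Typed: `MeromorphicOn (liModelH n) univ`, and
`H_n(x) ∈ ℝ` at every real `x` with `ξ(x) + ξ′(x) ≠ 0` (the real line carries no zero of `ξ`;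
at a real zero of `ξ + ξ′` — a possible pole — the Lean value is junk, hence the proviso).
Printed proof: Lemma 2.1 + Prop. 2.1, and "trivial by definition (1.4)".
[cite: Suzuki2023b, Prop. 2.3 (1), p. 6 L103–104] -/
def Suzuki2023b_prop23_1 : Prop :=
  ∀ n : ℕ, 1 ≤ n →
    MeromorphicOn (liModelH n) Set.univ ∧
    ∀ x : ℝ, riemannXi x + deriv riemannXi x ≠ 0 → (liModelH n (x : ℂ)).im = 0

/-- RH-FREE. **[Su23b] Proposition 2.3 (2)**: "`H_n(s)` are neither real nor purely imaginary
valued on the line `Re(s) = 1/2` in general". The printed proof establishes this for `n = 1`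
only ("Formula (1.8) shows that `H_1(s)` is neither real nor purely imaginary valued on the line
`Re(s) = 1/2`, since `ξ′/ξ(s)` takes non-constant pure imaginary values on `Re(s) = 1/2`"); typed
as that `n = 1` statement ("in general" is not a quantifier we can type).
[cite: Suzuki2023b, Prop. 2.3 (2), p. 6 L106, proof L131–134] -/
def Suzuki2023b_prop23_2 : Prop :=
  (¬ ∀ t : ℝ, (liModelH 1 (1 / 2 + t * I)).im = 0) ∧
    ¬ ∀ t : ℝ, (liModelH 1 (1 / 2 + t * I)).re = 0

/-- RH-FREE. **[Su23b] Proposition 2.3 (3)**: "`H_n(s)` are analytic in `ℂ` except for points `λ`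
such that `ξ(λ)+ξ′(λ) = 0` and `λ ∉ 𝒵`. In particular, `s = 0` and `s = 1` are not poles of
`H_n(s)`." Typed: `H_n` is analytic at every `s` with `ξ(s)+ξ′(s) ≠ 0` or `ξ(s) = 0`, and at `0`
and at `1`. [cite: Suzuki2023b, Prop. 2.3 (3), p. 6 L112–114] -/
def Suzuki2023b_prop23_3 : Prop :=
  ∀ n : ℕ, 1 ≤ n →
    (∀ s : ℂ, (riemannXi s + deriv riemannXi s ≠ 0 ∨ riemannXi s = 0) →
      AnalyticAt ℂ (liModelH n) s) ∧
    AnalyticAt ℂ (liModelH n) 0 ∧ AnalyticAt ℂ (liModelH n) 1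

/-- RH-FREE. **[Su23b] Proposition 2.3 (4)**: "If `λ` is a zero of `ξ(s)+ξ′(s)` of order `m`
and a zero of `M_n(s)` of order less than `m`, then it is a pole of `H_n(s)`" (for `λ ∉ 𝒵`,
where `M_n` is analytic — the sentence before (4): "Since `M_n(s)` is analytic outside `𝒵` …").
Typed with `analyticOrderAt` (order `0` = non-vanishing) and "pole" = `|H_n(s)| → ∞` as `s → λ`.
[cite: Suzuki2023b, Prop. 2.3 (4), p. 6 L116–123] -/
def Suzuki2023b_prop23_4 : Prop :=
  ∀ n : ℕ, 1 ≤ n → ∀ l : ℂ, l ∉ ZetaZeros.riemannZetaNontrivialZeros → ∀ m : ℕ, 1 ≤ m →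
    analyticOrderAt (fun s ↦ riemannXi s + deriv riemannXi s) l = m →
    analyticOrderAt (liModelM n) l < m →
      Tendsto (fun s ↦ ‖liModelH n s‖) (𝓝[≠] l) atTop

/-- RH-FREE. **[Su23b] Proposition 2.3 (5)**: "The set of zeros of `ξ(s)+ξ′(s)` and the set of
poles of `H_n(s)` are closed under complex conjugation" ("since `ξ(s)+ξ′(s)` and `H_n(s)` are
real valued on the real line"). "Pole at `λ`" = `|H_n(s)| → ∞` as `s → λ`.
[cite: Suzuki2023b, Prop. 2.3 (5), p. 6 L125–126] -/
def Suzuki2023b_prop23_5 : Prop :=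
  (∀ s : ℂ, riemannXi s + deriv riemannXi s = 0 →
    riemannXi (conj s) + deriv riemannXi (conj s) = 0) ∧
  ∀ n : ℕ, 1 ≤ n → ∀ l : ℂ,
    Tendsto (fun s ↦ ‖liModelH n s‖) (𝓝[≠] l) atTop →
      Tendsto (fun s ↦ ‖liModelH n s‖) (𝓝[≠] (conj l)) atTop

/-! ## §1: Theorem 1.1 -/

/-- RH-FREE. **[Su23b] Theorem 1.1, the sufficiency ("if") direction**: if
`λ_n = (2π)^{−1}‖G_n‖²_{L²(ℝ)}` for all positive integers `n`, then RH holds — "The Riemann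
hypothesis follows trivially from equation (1.6) by Li's criterion" (a squared norm is `≥ 0`;
the tree's `li_criterion_holds`). Discharged in the Proofs sibling.
[cite: Suzuki2023b, Thm. 1.1, p. 2 L100–113] -/
def Suzuki2023b_thm11_if : Prop :=
  (∀ n : ℕ, 1 ≤ n → keiperLiCoeff n = 1 / (2 * Real.pi) * liModelGNormSq n) → RiemannHypothesis

/-- RH-CONSEQUENCE (explicit `RiemannHypothesis →` binder; never an unconditional fact).
**[Su23b] Theorem 1.1, the necessity ("only if") direction** — "the nontrivial part of
Theorem 1.1": under RH, `λ_n = (2π)^{−1}‖G_n‖²_{L²(ℝ)}` for every `n ≥ 1`. Printed proof (§3.4):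
under RH the `F_γ` (Prop. 3.2) form an orthonormal basis of the model space `𝒦(Θ)`, `G_n`
expands as (3.6) with square-summable coefficients, whence (3.8); compare with (3.9). In this
module it is REDUCED to the single boundary statement `Suzuki2023b_eq_s301`
(`Suzuki2023b_thm11_onlyif_of_eq_s301` in the Proofs sibling).
[cite: Suzuki2023b, Thm. 1.1, p. 2 L100–115; proof §3.4, p. 8 L71–p. 9 L2] -/
def Suzuki2023b_thm11_onlyif : Prop :=
  RiemannHypothesis → ∀ n : ℕ, 1 ≤ n → keiperLiCoeff n = 1 / (2 * Real.pi) * liModelGNormSq n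

/-- RH-EQUIVALENT (line 1): **[Su23b] Theorem 1.1** as printed — "A necessary and sufficient
condition for the Riemann hypothesis is that `λ_n = (2π)^{−1}‖G_n‖²_{L²(ℝ)}` holds for all
positive integers `n`." Status of the two directions: ⟸ RH-FREE and trivial by Li's criterion
(`Suzuki2023b_thm11_if`, discharged); ⟹ RH-CONSEQUENCE (`Suzuki2023b_thm11_onlyif`, printed
proof via model spaces). This is Li's criterion with `λ_n ≥ 0` re-expressed as a norm identity;
it is nobody's proving target and is not progress toward RH.
[cite: Suzuki2023b, Thm. 1.1, p. 2 L100–111] -/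
def Suzuki2023b_thm11 : Prop :=
  RiemannHypothesis ↔ ∀ n : ℕ, 1 ≤ n → keiperLiCoeff n = 1 / (2 * Real.pi) * liModelGNormSq n

/-! ## §3.4: the two zero sums (3.8), (3.9) behind Theorem 1.1 -/

/-- RH-CONSEQUENCE (explicit `RiemannHypothesis →` binder). **[Su23b] eq. (3.8)**: under RH, for
`n ≥ 1`, `‖G_n‖² = π Σ_{γ∈Γ} m_γ {[1 − (1 − 1/(½−iγ))ⁿ] + [1 − (1 − 1/(½+iγ))ⁿ]}`, "where the
right-hand side converges absolutely under the curly brackets". With `ρ = ½ − iγ` one has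
`½ + iγ = 1 − ρ` identically, so the bracket is `[1−(1−1/ρ)ⁿ] + [1−(1−1/(1−ρ))ⁿ]`, summed over
`𝒵` with multiplicity (module dictionary); typed as a `HasSum` with value `‖G_n‖²/π`. This is the
model-space heart of Thm. 1.1 (Prop. 3.2: `{F_γ}` is an orthonormal basis of `𝒦(Θ)` under RH —
de Branges [dB68, Thm 22] + Makarov–Poltoratski [MaPo05, Thm 2.1]); it stays a named statement
here (boundary input F2 of the cell's FACT-LIST). [cite: Suzuki2023b, eq. (3.8), p. 8 L140–157] -/
def Suzuki2023b_eq_s301 : Prop :=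
  RiemannHypothesis → ∀ n : ℕ, 1 ≤ n →
    HasSum (fun ρ : ZetaZeros.riemannZetaNontrivialZeros ↦
        (riemannZetaZeroOrder (ρ : ℂ) : ℂ) *
          ((1 - (1 - 1 / (ρ : ℂ)) ^ n) + (1 - (1 - 1 / (1 - (ρ : ℂ))) ^ n)))
      ((liModelGNormSq n / Real.pi : ℝ) : ℂ)

/-- RH-FREE (printed under RH, where `Γ ⊂ ℝ`; the identity holds unconditionally).
**[Su23b] eq. (3.9)**: for `n ≥ 1`,
`λ_n = ½ Σ_{γ∈Γ} m_γ {[1 − (1 − 1/(½−iγ))ⁿ] + [1 − (1 − 1/(½+iγ))ⁿ]}`, the bracketed series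
converging absolutely ("since `Γ` is closed under `γ ↦ −γ`" and (1.1)). In the tree's indexing
(bracket `[1−(1−1/ρ)ⁿ] + [1−(1−1/(1−ρ))ⁿ]` over `𝒵`, value `2λ_n`); it follows from the PROVED
`keiperLiCoeff_eq_tsum_zeros` (`λ_n = Σ′ m(ρ) Re[1−(1−1/ρ)ⁿ]`) and the symmetries `ρ ↦ 1−ρ`,
`ρ ↦ ρ̄` of `𝒵` — discharged in the Proofs sibling.
[cite: Suzuki2023b, eq. (3.9), p. 8 L159–p. 9 L1] -/
def Suzuki2023b_eq_s302 : Prop :=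
  ∀ n : ℕ, 1 ≤ n →
    HasSum (fun ρ : ZetaZeros.riemannZetaNontrivialZeros ↦
        (riemannZetaZeroOrder (ρ : ℂ) : ℂ) *
          ((1 - (1 - 1 / (ρ : ℂ)) ^ n) + (1 - (1 - 1 / (1 - (ρ : ℂ))) ^ n)))
      ((2 * keiperLiCoeff n : ℝ) : ℂ)

/-! ## §4.2: the explicit relation between `g_n` and `G_n` -/

/-- RH-FREE (pointwise identity). **[Su23b] eq. (3.6) / §4.2 "`G_n = 𝒯(g_n)`"**: for `n ≥ 1`,
at every `z` with `ξ(½−iz) ≠ 0` and `E(z) ≠ 0`,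
`G_n(z) = Σ_{ρ∈𝒵} m_ρ [1 − (1 − 1/ρ)ⁿ] · i(1+Θ(z))/(2(z−γ_ρ))`, `γ_ρ = i(ρ − ½)`
(`suzukiZeroParam`), absolutely convergent: "Substituting `s = 1/2 − iz` into (2.1) and (2.2), and
then using (3.5) [`F_γ = √(m_γ/π)·i(1+Θ(z))/(2(z−γ))`] … since `iξ(s)/(ξ(s)+ξ′(s)) = i(1+Θ(z))/2`".
The printed (3.6) carries `√(π m_γ)·F_γ(z) = m_γ·i(1+Θ(z))/(2(z−γ))`, as here. WHAT IS RH in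
print: that under RH this is an ORTHONORMAL EXPANSION in `𝒦(Θ)` (Prop. 3.2), i.e. §4.2's
`G_n = 𝒯(g_n)` with `𝒯(f) := Σ_ρ √(π m_ρ) f̂(ρ) F_γ` and `W(f ∗ \overline{x^{−1}f(x^{−1})}) =
π^{−1}‖𝒯f‖²` ("the subject of [Su23]", i.e. of `SuzukiWeilHilbertSpaceDefs.lean`) — not typed
here; the pointwise identity is a corollary of Prop. 2.1 and is discharged with it.
[cite: Suzuki2023b, eq. (3.6), p. 8 L85–96; §4.2, p. 10 L93–100] -/
def Suzuki2023b_eq0225_1 : Prop :=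
  ∀ n : ℕ, 1 ≤ n → ∀ z : ℂ, riemannXi (1 / 2 - I * z) ≠ 0 → lagariasE z ≠ 0 →
    HasSum (fun ρ : ZetaZeros.riemannZetaNontrivialZeros ↦
        (riemannZetaZeroOrder (ρ : ℂ) : ℂ) * (1 - (1 - 1 / (ρ : ℂ)) ^ n) *
          (I * (1 + lagariasTheta z) / (2 * (z - suzukiZeroParam ρ))))
      (liModelG n z)

/-- RH-FREE. **The Mellin transform of `g_n`** ([Su23b] §4.2: "`ĝ_n(ρ) = 1 − (1 − 1/ρ)ⁿ`",
`f̂(s) := ∫₀^∞ f(x)x^{s−1}dx`; in the proof of Prop. 2.1, p. 4: "`∫₀^∞ g_n(x)x^{ρ−1}dx =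
[1 − (1 − 1/ρ)ⁿ]` when `Re(ρ) > 0` by [BoLa99, Lemma 2]"): for `n ≥ 1` and `Re ρ > 0`,
`∫_{(0,∞)} g_n(x) x^{ρ−1} dx = 1 − (1 − 1/ρ)ⁿ`. Elementary (`∫₀¹ (log x)^{j−1}x^{ρ−1}dx =
(−1)^{j−1}(j−1)!/ρ^j` and the binomial theorem); to be discharged.
[cite: Suzuki2023b, §4.2, p. 10 L95–97; proof of Prop. 2.1, p. 4 L88–93 (= BombieriLagarias1999, Lemma 2)] -/
def Suzuki2023b_mellin_testFun : Prop :=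
  ∀ n : ℕ, 1 ≤ n → ∀ ρ : ℂ, 0 < ρ.re →
    ∫ x in Set.Ioi (0 : ℝ), (bombieriLagariasTestFun n x : ℂ) * (x : ℂ) ^ (ρ - 1) =
      1 - (1 - 1 / ρ) ^ n

end Literature.NumberTheory.LFunctions
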